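import Summits.Ventures.HSemireg.WedgeHankelRecurrenceGaussChebyshevTCommonFactor

/-!
# Venture HSemireg — **STRONG DIVISIBILITY OF THE SECOND-KIND CHEBYSHEV POLYNOMIALS: `U_n ∣ U_m ⟺ (n+1) ∣ (m+1)`** (Mathlib's `U`, fields with `2 ≠ 0`): the reduction
# **`U_n ∣ U_{j+k(n+1)} − U_j U_{n+1}^k`** (addition formula N453, any commutative ring), coprimality of `U_n`, `U_{n+1}` (N445), and a degree count for the remainder `U_{r−1}`; with N453 ∕ N454 this
# is the node-set statement «the zeros of `U_n` are among those of `U_m` iff `(n+1) ∣ (m+1)`» (nested second-kind Gauss–Chebyshev ∕ Fejér rules exactly along multiples)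

HONEST FRAMING. Part of the Lean index of the computation cell `pub-hsemireg` (seat p10 gen 47, Sunday typer «UNIFORM-IN-n»).  Polynomial algebra only; no variety, no cohomology theory, no
sheaf, no Ext group and no semiregularity map is constructed here; nothing here says that HC / HC_CM / HC_AV holds; no Literature fact (unproved `Prop`) is declared or used.  Custodian versions as
in `WedgeHankelSiegelIdeal` (1/3).
SOURCES (cited).  M. O. Rayes, V. Trevisan, P. S. Wang, *Factorization properties of Chebyshev polynomials*, Comput. Math. Appl. 50 (2005) 1231–1240, Thm 5 ∕ Cor. (`U_n ∣ U_m ⟺ (n+1) ∣ (m+1)`);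
J. C. Mason, D. C. Handscomb, *Chebyshev Polynomials* (2003), §1.2, Ch. 8.  Typed here algebraically.
PROOF TYPED HERE.  N453 `chebyshevU_add`; N445 `chebyshev_isCoprime_U_succ`; N438 `chebyshevU_dvd_U_mul_pred`; Mathlib `IsCoprime.pow_right`, `IsCoprime.dvd_of_dvd_mul_right`,
`eq_zero_of_dvd_of_natDegree_lt`, `natDegree_U_natCast`, `U_ne_zero`, `Nat.div_add_mod`.
DEDUP DISCLOSURE (`rg -n -i 'U_dvd_iff|dvd_U_iff' Summits/Ventures/HSemireg`, 2026-09-04): N438 (the `⇐` direction); 0 hits for the 2 names below.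

WHAT IS IN THE TREE.  N438, N445, N453, N454.
THIS FILE (namespace `Summit.Ventures.HSemireg.Wedge.HankelOuter` continued; CHAINED on N455; 0 definitions):
* §1221 **`chebyshevU_dvd_add_mul_sub`** (`U_n ∣ U_{j+k(n+1)} − U_j U_{n+1}^k`), **`chebyshevU_dvd_iff`** (`U_n ∣ U_m ⟺ (n+1) ∣ (m+1)`).
CAVEATS.  Fields with `2 ≠ 0` for the iff.  Nothing Ext-side.  New names only.
-/

open Module Polynomial
open scoped Matrix Polynomial

namespace Summit.Ventures.HSemireg.Wedge.HankelOuter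

/-! ## §1221. `U_n ∣ U_m ⟺ (n+1) ∣ (m+1)` -/

/-- **`U_n ∣ U_{j+k(n+1)} − U_j · U_{n+1}^k`** (`j, n ∈ ℤ`, `k ∈ ℕ`, any commutative ring). [from the addition formula; this file, §1221] -/
theorem chebyshevU_dvd_add_mul_sub {R : Type*} [CommRing R] (j n : ℤ) (k : ℕ) :
    Polynomial.Chebyshev.U R n ∣ Polynomial.Chebyshev.U R (j + k * (n + 1)) - Polynomial.Chebyshev.U R j * Polynomial.Chebyshev.U R (n + 1) ^ k := by
  induction k with
  | zero => simp only [Nat.cast_zero, zero_mul, add_zero, pow_zero, mul_one, sub_self, dvd_zero]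
  | succ k ih =>
    obtain ⟨c, hc⟩ := ih
    have hadd := chebyshevU_add (R := R) (j + k * (n + 1)) (n + 1)
    rw [add_sub_cancel_right] at hadd
    refine ⟨c * Polynomial.Chebyshev.U R (n + 1) - Polynomial.Chebyshev.U R (j + k * (n + 1) - 1), ?_⟩
    rw [Nat.cast_succ, show j + ((k : ℤ) + 1) * (n + 1) = j + k * (n + 1) + (n + 1) by ring, hadd, pow_succ]
    linear_combination Polynomial.Chebyshev.U R (n + 1) * hc

/-- **STRONG DIVISIBILITY: `U_n ∣ U_m ⟺ (n+1) ∣ (m+1)`** over a field with `2 ≠ 0`. [Rayes–Trevisan–Wang 2005; this file, §1221] -/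
theorem chebyshevU_dvd_iff {K : Type*} [Field K] (h2 : (2 : K) ≠ 0) (n m : ℕ) :
    Polynomial.Chebyshev.U K (n : ℤ) ∣ Polynomial.Chebyshev.U K (m : ℤ) ↔ (n + 1) ∣ (m + 1) := by
  haveI : NeZero (2 : K) := ⟨h2⟩
  constructor
  · intro hdvd
    set q := (m + 1) / (n + 1) with hq
    set r := (m + 1) % (n + 1) with hr
    have hdm : (n + 1) * q + r = m + 1 := Nat.div_add_mod (m + 1) (n + 1)
    have hrlt : r < n + 1 := Nat.mod_lt _ (Nat.succ_pos n)
    -- `m = (r − 1) + q (n+1)` as integers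
    have hidx : (m : ℤ) = ((r : ℤ) - 1) + (q : ℤ) * ((n : ℤ) + 1) := by
      have h := congrArg (fun x : ℕ => (x : ℤ)) hdm
      push_cast at h
      linarith
    have hred := chebyshevU_dvd_add_mul_sub (R := K) ((r : ℤ) - 1) (n : ℤ) q
    rw [← hidx] at hred
    have h1 : Polynomial.Chebyshev.U K (n : ℤ) ∣ Polynomial.Chebyshev.U K ((r : ℤ) - 1) * Polynomial.Chebyshev.U K ((n : ℤ) + 1) ^ q := by
      have := dvd_sub hdvd hred
      rwa [sub_sub_cancel] at this
    have hcop : IsCoprime (Polynomial.Chebyshev.U K (n : ℤ)) (Polynomial.Chebyshev.U K ((n : ℤ) + 1) ^ q) := (chebyshev_isCoprime_U_succ (R := K) (n : ℤ)).symm.pow_right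
    have h2' : Polynomial.Chebyshev.U K (n : ℤ) ∣ Polynomial.Chebyshev.U K ((r : ℤ) - 1) := hcop.dvd_of_dvd_mul_right h1
    -- degree count: `U_{r−1} = 0` unless `r = 0`
    rcases Nat.eq_zero_or_pos r with hr0 | hrpos
    · exact Nat.dvd_of_mod_eq_zero hr0
    · exfalso
      obtain ⟨s, hs⟩ : ∃ s : ℕ, r = s + 1 := ⟨r - 1, by omega⟩
      have hz : Polynomial.Chebyshev.U K ((r : ℤ) - 1) = 0 := by
        refine Polynomial.eq_zero_of_dvd_of_natDegree_lt h2' ?_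
        rw [hs, show (((s + 1 : ℕ)) : ℤ) - 1 = (s : ℤ) by push_cast; ring, Polynomial.Chebyshev.natDegree_U_natCast, Polynomial.Chebyshev.natDegree_U_natCast]
        omega
      exact Polynomial.Chebyshev.U_ne_zero K _ (by rw [hs]; push_cast; omega) hz
  · rintro ⟨k, hk⟩
    have h := chebyshevU_dvd_U_mul_pred (R := K) k (n : ℤ)
    rwa [show (k : ℤ) * ((n : ℤ) + 1) - 1 = (m : ℤ) by
      have e := congrArg (fun x : ℕ => (x : ℤ)) hk; push_cast at e; linarith] at h

end Summit.Ventures.HSemireg.Wedge.HankelOuter
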